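import Summits.Ventures.CertifiedManyBodySolver.Rows.CorrWindowCertKernelChainQuotAdj
import HarnessLib

/-!
# Assembling a long `ChainQAOK` WITHOUT a many-armed `Fin` match: step ranges `StepsQA … a b`, built by `cons`/`nil` per chain file and
# joined by `append`

HONEST FRAMING: Lean plumbing towards «tier P» (cell hubbard-obs). MEASURED (algo-p2 g29, HOME/STATUS 2026-08-29T01:05:35Z): the Rm2
certificate's chain has M = 292 steps with adjoint halving (536 without), spread over ≈ 55–65 chain files; the closers of record
(`Rows/CorrWindowCertKernelChainQuotAdjNearCloser.lean`, `Rows/CARPolyWindowGramTBRows.lean`) consume ONE `ChainQAOK D B M Cs Ts Hs`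
whose `step` field the toys fill by a `match` on `Fin M` with one arm per step — fine at M = 3, unwise at M = 292. Here: the step
predicate `StepQA D B Cs Ts Hs i`, the RANGE predicate `StepsQA D B Cs Ts Hs a b` (steps `a ≤ i < b`), its constructors `StepsQA.nil`,
`StepsQA.cons` (one step in front), `StepsQA.snoc`, `StepsQA.append` (two adjacent ranges), and `chainQAOK_of_stepsQA` (range `0 … M` +
`Ts.length = M` ⇒ `ChainQAOK`). An assembly file writes, per chain file j, `have Sⱼ : StepsQA D B Cs Ts Hs aⱼ bⱼ := .cons fⱼ.step_a (.cons
… .nil)` (the per-file step theorems about NAMED accumulators are accepted by definitional unfolding of `Cs.getD`/`Hs.getD` on the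
assembly's literal lists) and then `chainQAOK_of_stepsQA hlen (S₁.append (S₂.append …))` — terms only, no tactic search, depth = steps
per file. Nothing of record; no certificate evaluated; CONTROL/CALIBRATION context (wording (xx1)); no summit statement is proved by this
file. Seat hubbard-obs-p2 (STIFFNESS), `prover-hubbard-obs-p2-g24-0`, zero compute.

References: C. Jansson, D. Chaykin, C. Keil, SIAM J. Numer. Anal. 46 (2008) 180 (staged rigorous replay) [JanssonChaykinKeil2008].
-/

namespace Summit.Ventures.CertifiedManyBodySolver

namespace CARPolyWindow

open Summit.Ventures.CertifiedQuantumChemistry Summit.Ventures.CertifiedQuantumChemistry.CARPoly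
open Literature.MathematicalPhysics.QuantumLattice Literature.MathematicalPhysics.QuantumLattice.HubbardWave0

section Steps

variable {N Nβ : ℕ}

/-- **Step `i` of a hinted, adjoint-canonicalising chain**: accumulator `i+1` IS the step of accumulator `i`. [cite: JanssonChaykinKeil2008, §3] -/
def StepQA (D : QuotData N Nβ) (B : ℕ) (Cs : List SOSDual.EncPoly) (Ts : List (Terms (Orb (Fin N)))) (Hs : List (List (QHint Nβ)))
    (i : ℕ) : Prop :=
  Cs.getD (i + 1) [] = stepEQA D B (Cs.getD i []) (Ts.getD i []) (Hs.getD i [])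

/-- **The steps `a ≤ i < b` hold.** [folklore] -/
def StepsQA (D : QuotData N Nβ) (B : ℕ) (Cs : List SOSDual.EncPoly) (Ts : List (Terms (Orb (Fin N)))) (Hs : List (List (QHint Nβ)))
    (a b : ℕ) : Prop :=
  ∀ i, a ≤ i → i < b → StepQA D B Cs Ts Hs i

variable {D : QuotData N Nβ} {B : ℕ} {Cs : List SOSDual.EncPoly} {Ts : List (Terms (Orb (Fin N)))} {Hs : List (List (QHint Nβ))}

/-- The empty range. [folklore] -/
theorem StepsQA.nil (a : ℕ) : StepsQA D B Cs Ts Hs a a := fun _ h₁ h₂ => absurd (lt_of_le_of_lt h₁ h₂) (lt_irrefl _)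

/-- Any range with `b ≤ a` is empty. [folklore] -/
theorem StepsQA.of_le {a b : ℕ} (h : b ≤ a) : StepsQA D B Cs Ts Hs a b := fun _ h₁ h₂ => absurd (lt_of_lt_of_le h₂ h) (not_lt.2 h₁)

/-- **One step in front of a range.** [folklore] -/
theorem StepsQA.cons {a b : ℕ} (h : StepQA D B Cs Ts Hs a) (hs : StepsQA D B Cs Ts Hs (a + 1) b) : StepsQA D B Cs Ts Hs a b := by
  intro i h₁ h₂
  rcases Nat.eq_or_lt_of_le h₁ with rfl | hlt
  · exact h
  · exact hs i hlt h₂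

/-- **One step behind a range.** [folklore] -/
theorem StepsQA.snoc {a b : ℕ} (hs : StepsQA D B Cs Ts Hs a b) (h : StepQA D B Cs Ts Hs b) : StepsQA D B Cs Ts Hs a (b + 1) := by
  intro i h₁ h₂
  rcases Nat.lt_succ_iff_lt_or_eq.1 h₂ with hlt | rfl
  · exact hs i h₁ hlt
  · exact h

/-- **Two adjacent ranges.** [folklore] -/
theorem StepsQA.append {a b c : ℕ} (h₁ : StepsQA D B Cs Ts Hs a b) (h₂ : StepsQA D B Cs Ts Hs b c) : StepsQA D B Cs Ts Hs a c := by
  intro i ha hc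
  rcases Nat.lt_or_ge i b with hb | hb
  · exact h₁ i ha hb
  · exact h₂ i hb hc

/-- A single step as a range. [folklore] -/
theorem StepsQA.single {a : ℕ} (h : StepQA D B Cs Ts Hs a) : StepsQA D B Cs Ts Hs a (a + 1) := StepsQA.cons h (StepsQA.nil _)

/-- **The full range + the length fact IS `ChainQAOK`.** [cite: JanssonChaykinKeil2008, §3] -/
theorem chainQAOK_of_stepsQA {M : ℕ} (hlen : Ts.length = M) (h : StepsQA D B Cs Ts Hs 0 M) : ChainQAOK D B M Cs Ts Hs where
  len := hlen
  step i := h i.val (Nat.zero_le _) i.isLt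

/-- And back: `ChainQAOK` gives every range below `M`. [folklore] -/
theorem stepsQA_of_chainQAOK {M : ℕ} (h : ChainQAOK D B M Cs Ts Hs) {a b : ℕ} (hb : b ≤ M) : StepsQA D B Cs Ts Hs a b :=
  fun i _ hi => h.step ⟨i, lt_of_lt_of_le hi hb⟩

end Steps

end CARPolyWindow

end Summit.Ventures.CertifiedManyBodySolver
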